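import Summits.HodgeConjecture.HodgeConjecture.Theorems.R90S4EpsClassesOverNormFinite    -- ★ p863871 (this seat): (FIN) hypothesis-first over (K-FIN), the count = size of a transversal (brings ★ α `R90S4TwistedCartanNormFibres`, ★ `R90S4CartanNormMap`)
import Literature.NumberTheory.LocalFields.EtaleAlgebraSquareClassesFinite               -- ★ (B6) `exists_finset_units_forall_eq_mul_sq` (square classes of a finite étale algebra over a local field)
import Literature.NumberTheory.Rogawski1990.CartanAlgebra                                -- ★ `cartanAlgebra`, `hermStar`, `mul_comm_of_mem_cartanAlgebra`, `hermStar_mem_cartanAlgebra`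
import Literature.LinearAlgebra.Matrix.HermitianAdjointCartanAlgebra                     -- ★ `mem_adjoin_singleton_of_commute`, `isReduced_adjoin_singleton` (`Z(γ) = L[γ]` is reduced)
import Literature.NumberTheory.Automorphic.AdicCompletionLocalField                      -- ★ `IsNonarchimedeanLocalField (v.adicCompletion K)` (instance)
import Literature.NumberTheory.Automorphic.QuadraticLocalBaseChange                      -- ★ `algebraLocalRing` (`L ⊗ L⁺_v` as an `L⁺_v`-algebra), `conjLocal_toLocalRing`, `conjLocal_algebraMap`, `moduleFinite_localRing`
import Literature.NumberTheory.Automorphic.UnitaryGroupNonsplitPlace                     -- ★ `LocalRing.isField_of_smul_eq` (`L ⊗ L⁺_v` is a field at a non-split place)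
import HarnessLib

/-!
# R90-TF · S4 «Ch. 13.1–2», T-WIF road, head A4 (FIN) DISCHARGED — the letter (K-FIN): `T̃ᴺ` is covered by finitely many `(1−ε)T̃`-cosets, hence the ε-classes over a
# regular `γ` are finitely many (Rogawski 1990, §3.5 Prop. 3.5.2 p. 25: `H¹(F,T) ≅ K^× ∕ N(K′^×)` finite; §3.11 Prop. 3.11.1 (c) p. 34; §12.5 p. 186)

Cell `hodgecm-mathlib`, crux H413 (`stmt-HodgeConjecture-24833`, lane `--supports … --as helper`), route of record `HCCMUnconditional` (no route verbs; count-neutral).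
Programme R90-TF, section S4, dealer K2E2-plan (g7): S4-R27 (3) «A4 (FIN) + (IDX) → p27»; seat K2E3-p27 (g3).  Sequel of ★ `R90S4EpsClassesOverNormFinite` (this seat), whose
letter (K-FIN) is discharged here at every NON-SPLIT place for every hermitian form `Φ`.  THEOREMS ONLY — no `def`, no instance, no notation, no `sorry`; ★-only imports.

## THE MATHEMATICS
`G̃_v = GL₃(L ⊗ L⁺_v)`, `ε = epsLoc L Φ v` with `ε(g) = Φ_v⁻¹((σg)ᵀ)⁻¹Φ_v`, so (§1) `ε(s)⁻¹ = s⋆` (`⋆ = hermStar σ Φ_v`, ★ `Ch4Sec10.coe_unitaryTwist`): `s · ε(s)⁻¹ = s·s⋆` is a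
`⋆`-NORM and `N u = u ε(u) = 1 ⟺ u⋆ = u`.  Hence for `γ ∈ G_v` regular, `T̃ = Cent(γ) = Z(γ)ˣ` (★ `cartanAlgebra`), `T̃ᴺ = (Z(γ)^⋆)ˣ` = the units of the `⋆`-FIXED algebra
`A = Z(γ)^⋆` and `(1−ε)T̃ = {s s⋆}`.  At a non-split `v` the base `L ⊗ L⁺_v = L_w` is a field (★ `LocalRing.isField_of_smul_eq`), `Z(γ) = L_w[γ]` is commutative and reduced (★
`mem_adjoin_singleton_of_commute`, ★ `isReduced_adjoin_singleton`), and `A` is a reduced finite-dimensional commutative algebra over the local field `F_v = L⁺_v` (★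
`algebraLocalRing`, ★ `moduleFinite_localRing`; `⋆` is `F_v`-linear by ★ `conjLocal_toLocalRing`).  By ★ (B6) `exists_finset_units_forall_eq_mul_sq` the square classes `Aˣ ∕ Aˣ²`
are FINITE, and `c² = c·c⋆` for `c ∈ A`: (§2) **`exists_finset_normCosets`** — the letter (K-FIN) of ★ `finite_setOf_isStablyEpsConjAt_of_normCosetsFinite`, hence (§3)
**`finite_setOf_isStablyEpsConjAt`**: for `γ` regular and `γ ∈ 𝒩(δ₀)`, the index set `{c | IsStablyEpsConjAt … δ₀ (out c)}` of the stable ε-orbital integral is FINITE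
[§3.11 Prop. 3.11.1 (c): `𝒟_ε(δ∕F)` finite].  The exact count per Cartan type ((IDX): `|T̃ᴺ ∕ (1−ε)T̃| = |H¹(F,T)| = 2^{r′}`) is the sequel.

## CONTENTS
* §1 `coe_epsLoc_inv` (`(ε s)⁻¹ = s⋆` on matrices), `epsNorm_eq_one_iff_hermStar_eq` (`N u = 1 ↔ u⋆ = u`), `formLocal_map_conjLocal_transpose` (`Φ_v` is `σ`-hermitian),
  `coe_mem_unitaryGroup_formLocal` (`G_v ⊆ U(σ, Φ_v)` in the ★ `ShimuraVarieties.unitaryGroup` rendering).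
* §2 **`exists_finset_normCosets`** ((K-FIN) at a non-split place).
* §3 **`finite_setOf_isStablyEpsConjAt`** ((FIN) unconditional at a non-split place).

HONEST LABEL: HC_CM is proved only modulo the 7 printed citations (2 remaining named inputs: hLiu418 = stmt-HodgeConjecture-24832, h413 = stmt-HodgeConjecture-24833) until rung 0
closes.  Local algebra toward T-WIF (B1); discharges no named input; (W-NP) ∕ (B1) ∕ (1D-CT)_ns OPEN.  REL ≠ ★ ≠ BUILT.

## References
* [Rogawski1990] J. D. Rogawski, *Automorphic Representations of Unitary Groups in Three Variables*, Ann. of Math. Stud. 123 (1990), §3.5 Prop. 3.5.2 pp. 25–26 (`H¹(F,T)`),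
  §3.10 p. 33 (`ε`), §3.11 Prop. 3.11.1 (c) p. 34, §12.5 p. 186 (`T̃ᴺ`, `(1−ε)T̃`).
* [NeukirchANT1999] J. Neukirch, *Algebraic Number Theory* (1999), Ch. II (5.8) Cor. (finiteness of square classes over a local field).
-/

set_option autoImplicit false
-- the mandated namespace repeats the single-problem summit's segment (`HodgeConjecture.HodgeConjecture`)
set_option linter.dupNamespace false

noncomputable section

open scoped NumberField Matrix MatrixGroups

namespace Summit.HodgeConjecture.HodgeConjecture.R90.S4

open Literature.NumberTheory.Rogawski1990 Literature.NumberTheory.Rogawski1990.Ch4Sec10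
open Literature.NumberTheory.Automorphic Literature.NumberTheory.Automorphic.UnitaryGroup Literature.NumberTheory.LocalFields
open Literature.AlgebraicGeometry.ShimuraVarieties (unitaryGroup mem_unitaryGroup_iff)
open Literature.LinearAlgebra.Matrix (mem_adjoin_singleton_of_commute isReduced_adjoin_singleton)
open Summit.HodgeConjecture.HodgeConjecture.Cruxes.H413.K2E1GlobalTestFunctionsTwisted (formLocal twistLocal)
open IsDedekindDomain NumberField

section EpsStar

variable (L : Type) [Field L] [NumberField L] [IsCMField L] (Φ : GL (Fin 3) L) (v : HeightOneSpectrum (𝓞 ↥(maximalRealSubfield L)))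

/-! ## §1 `ε` versus `⋆`: `ε(s)⁻¹ = s⋆`, `N u = 1 ↔ u⋆ = u`, `Φ_v` hermitian, `G_v ⊆ U(σ, Φ_v)` -/

/-- **`ε(s)⁻¹ = s⋆` on matrices**: `((ε s)⁻¹).val = Φ_v⁻¹ ᵗ(σ s) Φ_v = hermStar σ Φ_v s` (`ε(g) = Φ_v⁻¹((σg)⁻¹)ᵀΦ_v`, ★ `coe_unitaryTwist`, and `ε` is a homomorphism).
[cite: Rogawski1990, §3.10 p. 33] -/
theorem coe_epsLoc_inv (s : GtLoc L v) :
    ((epsLoc L Φ v s)⁻¹).val = hermStar (conjLocal L (IsCMField.complexConj L) v) (formLocal L 3 Φ v).val s.val := by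
  rw [← map_inv, epsLoc_apply]
  change (unitaryTwist (conjLocal L (IsCMField.complexConj L) v) (formLocal L 3 Φ v) s⁻¹).val = _
  rw [coe_unitaryTwist, map_inv, inv_inv, hermStar_def, Matrix.coe_units_inv]
  rfl

/-- **`N u = 1 ↔ u⋆ = u`**: the kernel `T̃ᴺ` of the norm consists of the `⋆`-FIXED elements (`N u = 1 ↔ ε u = u⁻¹ ↔ (ε u)⁻¹ = u`, ★ `epsNorm_eq_one_iff`).
[cite: Rogawski1990, §12.5 p. 186] -/
theorem epsNorm_eq_one_iff_hermStar_eq (u : GtLoc L v) :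
    epsNorm (epsLoc L Φ v) u = 1 ↔ hermStar (conjLocal L (IsCMField.complexConj L) v) (formLocal L 3 Φ v).val u.val = u.val := by
  rw [epsNorm_eq_one_iff, ← coe_epsLoc_inv]
  constructor
  · intro h
    rw [h, inv_inv]
  · intro h
    have h' : (epsLoc L Φ v u)⁻¹ = u := Units.ext h
    rw [← inv_inv (epsLoc L Φ v u), h']

/-- **`Φ_v` is `σ`-hermitian**: `ᵗ(σ Φ_v) = Φ_v` for `Φ` hermitian (`Φ_v = Φ ⊗ 1`, `σ ∘ (L → L ⊗ L⁺_v) = (L → L ⊗ L⁺_v) ∘ c`, ★ `conjLocal_algebraMap`). [cite: Rogawski1990, §1.9 p. 8] -/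
theorem formLocal_map_conjLocal_transpose (hΦ : ((Φ : GL (Fin 3) L) : Matrix (Fin 3) (Fin 3) L)ᵀ.map (IsCMField.complexConj L) = (Φ : Matrix (Fin 3) (Fin 3) L)) :
    ((formLocal L 3 Φ v).val.map (conjLocal L (IsCMField.complexConj L) v))ᵀ = (formLocal L 3 Φ v).val := by
  change (((Φ : Matrix (Fin 3) (Fin 3) L).map (algebraMap L (LocalRing L v))).map (conjLocal L (IsCMField.complexConj L) v))ᵀ =
    (Φ : Matrix (Fin 3) (Fin 3) L).map (algebraMap L (LocalRing L v))
  have hcomp : ((Φ : Matrix (Fin 3) (Fin 3) L).map (algebraMap L (LocalRing L v))).map (conjLocal L (IsCMField.complexConj L) v) =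
      ((Φ : Matrix (Fin 3) (Fin 3) L).map (IsCMField.complexConj L)).map (algebraMap L (LocalRing L v)) := by
    rw [Matrix.map_map, Matrix.map_map]
    congr 1
    funext e
    exact conjLocal_algebraMap (IsCMField.complexConj L) v e
  rw [hcomp, ← Matrix.transpose_map, ← Matrix.transpose_map, hΦ]


/-- **`G_v ⊆ U(σ, Φ_v)`** in the ★ `ShimuraVarieties.unitaryGroup` rendering of ★ `CartanAlgebra`: `ε(γ) = γ` for `γ ∈ G_v` (★ `epsLoc_apply_coe`) and the fixed points of
`ε = unitaryTwist σ Φ_v` are `unitaryGroup σ Φ_v` (★ `unitaryTwist_eq_self_iff_mem_unitaryGroup`). [cite: Rogawski1990, §3.10 p. 33] -/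
theorem coe_mem_unitaryGroup_formLocal (γ : (UnitaryGroup.cmDatum L 3 (Φ : Matrix (Fin 3) (Fin 3) L)).Local v) :
    (γ.val : GtLoc L v) ∈ unitaryGroup (conjLocal L (IsCMField.complexConj L) v) (formLocal L 3 Φ v).val :=
  (unitaryTwist_eq_self_iff_mem_unitaryGroup (conjLocal L (IsCMField.complexConj L) v) (formLocal L 3 Φ v) γ.val).1 (epsLoc_apply_coe L Φ v γ)

end EpsStar

section NormCosets

variable (L : Type) [Field L] [NumberField L] [IsCMField L] (Φ : GL (Fin 3) L) (v : HeightOneSpectrum (𝓞 ↥(maximalRealSubfield L)))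

/-! ## §2 (K-FIN) at a non-split place: `T̃ᴺ` is covered by finitely many `(1−ε)T̃`-cosets -/

variable {L Φ v} in
/-- **(K-FIN) — FINITELY MANY NORM COSETS.**  `v` non-split, `γ ∈ G_v` regular (ANY `Φ ∈ GL₃(L)`: no hermitian hypothesis is needed for this count): there is a finite `R ⊆ G̃_v` such that every `u ∈ T̃ = Cent(γ)` with `N u = 1` is
`r · s ε(s)⁻¹` with `r ∈ R`, `s ∈ T̃` — the letter `hK` of ★ `finite_setOf_isStablyEpsConjAt_of_normCosetsFinite`.  Proof: `T̃ᴺ` = the units of the `⋆`-fixed algebra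
`A = Z(γ)^⋆` (§1), a reduced finite-dimensional commutative algebra over the local field `L⁺_v`; ★ (B6) `exists_finset_units_forall_eq_mul_sq` gives square-class representatives
`T ⊆ Aˣ`, and `u = t·c² = t · (c·c⋆) = t · (c·ε(c)⁻¹)` for `c ∈ Aˣ` (`c⋆ = c`). [cite: Rogawski1990, §3.5 Prop. 3.5.2 p. 25; §12.5 p. 186] [cite: NeukirchANT1999, Ch. II (5.8) Cor.] -/
theorem exists_finset_normCosets (hns : ∀ w : PlacesOver L v, IsCMField.complexConj L • w.1 = w.1)
    {γ : (UnitaryGroup.cmDatum L 3 (Φ : Matrix (Fin 3) (Fin 3) L)).Local v} (hγ : IsRegularElt (γ.val : GtLoc L v)) :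
    ∃ R : Finset (GtLoc L v), ∀ u ∈ Subgroup.centralizer ({(γ.val : GtLoc L v)} : Set (GtLoc L v)), epsNorm (epsLoc L Φ v) u = 1 →
      ∃ r ∈ R, ∃ s ∈ Subgroup.centralizer ({(γ.val : GtLoc L v)} : Set (GtLoc L v)), u = r * (s * (epsLoc L Φ v s)⁻¹) := by
  classical
  obtain ⟨w⟩ := (inferInstance : Nonempty (PlacesOver L v))
  have hw := hns w
  letI : Field (LocalRing L v) := (LocalRing.isField_of_smul_eq (IsCMField.complexConj L) (IsCMField.complexConj_ne_one L) w hw).toField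
  haveI : Algebra.IsQuadraticExtension ↥(maximalRealSubfield L) L := IsCMField.isQuadraticExtension L
  -- notation
  set σ : LocalRing L v →+* LocalRing L v := conjLocal L (IsCMField.complexConj L) v with hσ_def
  set Hm : Matrix (Fin 3) (Fin 3) (LocalRing L v) := (formLocal L 3 Φ v).val with hHm_def
  set γm : Matrix (Fin 3) (Fin 3) (LocalRing L v) := (γ.val : GtLoc L v).val with hγm_def
  have hHu : IsUnit Hm.det := Matrix.isUnits_det_units (formLocal L 3 Φ v)
  have hsep : γm.charpoly.Separable := hγ
  have hγU : (γ.val : GtLoc L v) ∈ unitaryGroup σ Hm := coe_mem_unitaryGroup_formLocal L Φ v γ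
  have hcomm : ∀ a b : Matrix (Fin 3) (Fin 3) (LocalRing L v), a ∈ cartanAlgebra γm → b ∈ cartanAlgebra γm → a * b = b * a :=
    fun a b ha hb => mul_comm_of_mem_cartanAlgebra hsep ha hb
  have hstar : ∀ a : Matrix (Fin 3) (Fin 3) (LocalRing L v), a ∈ cartanAlgebra γm → hermStar σ Hm a ∈ cartanAlgebra γm :=
    fun a ha => hermStar_mem_cartanAlgebra σ Hm hHu hγU ha
  have hσscal : ∀ q : (v.adicCompletion ↥(maximalRealSubfield L)), σ (algebraMap _ (LocalRing L v) q) = algebraMap _ (LocalRing L v) q :=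
    fun q => conjLocal_toLocalRing (IsCMField.complexConj L) v q
  -- the `⋆`-fixed algebra `A = Z(γ)^⋆` over `F_v`
  let A : Subalgebra (v.adicCompletion ↥(maximalRealSubfield L)) (Matrix (Fin 3) (Fin 3) (LocalRing L v)) :=
    { carrier := {x | x ∈ cartanAlgebra γm ∧ hermStar σ Hm x = x}
      mul_mem' := fun {a b} ha hb => ⟨Subalgebra.mul_mem _ ha.1 hb.1, by rw [hermStar_mul σ Hm hHu, ha.2, hb.2, hcomm _ _ hb.1 ha.1]⟩
      one_mem' := ⟨Subalgebra.one_mem _, hermStar_one σ Hm hHu⟩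
      add_mem' := fun {a b} ha hb => ⟨Subalgebra.add_mem _ ha.1 hb.1, by rw [hermStar_add, ha.2, hb.2]⟩
      zero_mem' := ⟨Subalgebra.zero_mem _, by rw [← zero_smul (LocalRing L v) (0 : Matrix (Fin 3) (Fin 3) (LocalRing L v)), hermStar_smul, map_zero, zero_smul, zero_smul]⟩
      algebraMap_mem' := fun q => by
        have hq : algebraMap (v.adicCompletion ↥(maximalRealSubfield L)) (Matrix (Fin 3) (Fin 3) (LocalRing L v)) q =
            (algebraMap (v.adicCompletion ↥(maximalRealSubfield L)) (LocalRing L v) q) • (1 : Matrix (Fin 3) (Fin 3) (LocalRing L v)) := by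
          rw [Algebra.algebraMap_eq_smul_one, IsScalarTower.algebraMap_smul]
        refine ⟨?_, ?_⟩
        · rw [hq]; exact Subalgebra.smul_mem _ (Subalgebra.one_mem _) _
        · rw [hq, hermStar_smul, hermStar_one σ Hm hHu, hσscal] }
  have hAmem : ∀ {x : Matrix (Fin 3) (Fin 3) (LocalRing L v)}, x ∈ A ↔ x ∈ cartanAlgebra γm ∧ hermStar σ Hm x = x := fun {x} => Iff.rfl
  letI : CommRing ↥A := { (inferInstance : Ring ↥A) with mul_comm := fun a b => Subtype.ext (hcomm _ _ a.2.1 b.2.1) }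
  haveI : IsReduced ↥A := by
    refine ⟨fun a ha => ?_⟩
    obtain ⟨k, hk⟩ := ha
    have hak : a.1 ^ k = 0 := by
      have h := congrArg Subtype.val hk
      rwa [SubmonoidClass.coe_pow] at h
    let b : ↥(Algebra.adjoin (LocalRing L v) ({γm} : Set (Matrix (Fin 3) (Fin 3) (LocalRing L v)))) :=
      ⟨a.1, mem_adjoin_singleton_of_commute γm hsep (mem_cartanAlgebra_iff.1 a.2.1).symm⟩
    have hb : IsNilpotent b := ⟨k, Subtype.ext (by rw [SubmonoidClass.coe_pow]; exact hak)⟩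
    haveI := isReduced_adjoin_singleton γm hsep
    have hb0 : b = 0 := IsReduced.eq_zero b hb
    have ha0 : a.1 = 0 := by
      have h := congrArg Subtype.val hb0
      exact h
    exact Subtype.ext ha0
  haveI : FiniteDimensional (v.adicCompletion ↥(maximalRealSubfield L)) ↥A :=
    FiniteDimensional.of_injective A.val.toLinearMap Subtype.val_injective
  obtain ⟨T, hT⟩ := exists_finset_units_forall_eq_mul_sq (v.adicCompletion ↥(maximalRealSubfield L)) ↥A
  -- units of `A` as elements of `G̃_v`
  let toGL : (↥A)ˣ → GtLoc L v := fun t =>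
    ⟨t.val.val, t⁻¹.val.val,
      by rw [← Subalgebra.coe_mul, ← Units.val_mul, mul_inv_cancel, Units.val_one, Subalgebra.coe_one],
      by rw [← Subalgebra.coe_mul, ← Units.val_mul, inv_mul_cancel, Units.val_one, Subalgebra.coe_one]⟩
  have htoGL : ∀ t : (↥A)ˣ, (toGL t).val = t.val.val := fun _ => rfl
  refine ⟨T.image toGL, fun u huT hNu => ?_⟩
  -- `u` and `u⁻¹` as `⋆`-fixed elements of `Z(γ)`
  have hmemZ : ∀ {x : GtLoc L v}, x ∈ Subgroup.centralizer ({(γ.val : GtLoc L v)} : Set (GtLoc L v)) → x.val ∈ cartanAlgebra γm := by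
    intro x hx
    rw [mem_cartanAlgebra_iff, Commute, SemiconjBy]
    have h := Subgroup.mem_centralizer_singleton_iff.1 hx
    have h' := congrArg Units.val h
    simpa only [Units.val_mul] using h'
  have hNui : epsNorm (epsLoc L Φ v) u⁻¹ = 1 := by
    rw [epsNorm_eq_one_iff] at hNu ⊢
    rw [map_inv, hNu, inv_inv]
  have hus : hermStar σ Hm u.val = u.val := (epsNorm_eq_one_iff_hermStar_eq L Φ v u).1 hNu
  have huis : hermStar σ Hm (u⁻¹).val = (u⁻¹).val := (epsNorm_eq_one_iff_hermStar_eq L Φ v u⁻¹).1 hNui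
  let a : ↥A := ⟨u.val, hmemZ huT, hus⟩
  let ai : ↥A := ⟨(u⁻¹).val, hmemZ (Subgroup.inv_mem _ huT), huis⟩
  have haa : a * ai = 1 := Subtype.ext (by
    change u.val * (u⁻¹).val = 1
    rw [← Units.val_mul, mul_inv_cancel, Units.val_one])
  have haa' : ai * a = 1 := Subtype.ext (by
    change (u⁻¹).val * u.val = 1
    rw [← Units.val_mul, inv_mul_cancel, Units.val_one])
  let aU : (↥A)ˣ := ⟨a, ai, haa, haa'⟩
  obtain ⟨t, htT, c, hc⟩ := hT aU
  have hval : u.val = t.val.val * (c.val.val * c.val.val) := by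
    have h := congrArg (fun x : (↥A)ˣ => x.val.val) hc
    simpa only [Units.val_mul, pow_two, Subalgebra.coe_mul] using h
  refine ⟨toGL t, Finset.mem_image_of_mem _ htT, toGL c, ?_, ?_⟩
  · rw [Subgroup.mem_centralizer_singleton_iff]
    apply Units.ext
    rw [Units.val_mul, Units.val_mul, htoGL]
    exact (mem_cartanAlgebra_iff.1 c.val.2.1).eq
  · apply Units.ext
    rw [Units.val_mul, Units.val_mul, coe_epsLoc_inv, htoGL, htoGL, c.val.2.2]
    exact hval

/-! ## §3 (FIN) at a non-split place -/

variable {L Φ v} in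
/-- **(FIN) — THE ε-CLASSES OVER A REGULAR `γ` ARE FINITELY MANY** (`v` non-split, `Φ` hermitian, `γ ∈ G_v` regular, `γ ∈ 𝒩(δ₀)`): the index set
`{c | IsStablyEpsConjAt … δ₀ (out c)}` of the stable ε-orbital integral `Φ^{st}_ε(δ₀, ·)` (★ `stableEpsOrbitalIntegral_eq_finsum`) is finite — ★
`finite_setOf_isStablyEpsConjAt_of_normCosetsFinite` with (K-FIN) = §2.  Head A4 of the T-WIF heads sheet. [cite: Rogawski1990, §3.11 Prop. 3.11.1 (c) p. 34; §12.5 p. 186] -/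
theorem finite_setOf_isStablyEpsConjAt (hns : ∀ w : PlacesOver L v, IsCMField.complexConj L • w.1 = w.1)
    (hΦ : ((Φ : GL (Fin 3) L) : Matrix (Fin 3) (Fin 3) L)ᵀ.map (IsCMField.complexConj L) = (Φ : Matrix (Fin 3) (Fin 3) L))
    {γ : (UnitaryGroup.cmDatum L 3 (Φ : Matrix (Fin 3) (Fin 3) L)).Local v} (hγ : IsRegularElt (γ.val : GtLoc L v)) {δ₀ : GtLoc L v} (hδ₀ : IsEpsNormPair L Φ v δ₀ γ) :
    {c : EpsConjClassesMod (epsLoc L Φ v) ⊥ | IsStablyEpsConjAt L Φ v δ₀ (Quotient.out c)}.Finite :=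
  finite_setOf_isStablyEpsConjAt_of_normCosetsFinite hΦ hγ hδ₀ (exists_finset_normCosets hns hγ)

end NormCosets


end Summit.HodgeConjecture.HodgeConjecture.R90.S4

end
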